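import Literature.Probability.LatticeModels.GinibreInequalityFiniteSqrtExtension
import Literature.MathematicalPhysics.QuantumFieldTheory.ZnCentreDominatedWilsonLoops
import HarnessLib

/-!
# `ℤ_n` torus Wilson loops are non-decreasing in the coupling, for EVERY `n`
# (Griffiths' second inequality for the clock gauge group; Ginibre 1970, Example 4)

The tree's `zn_wilsonExpectation_wilsonLoop_mono` (`ZnCentreDominatedWilsonLoops.lean`) proves
`⟨W_{R×T}⟩_{ℤ_n,β,L} ≤ ⟨W_{R×T}⟩_{ℤ_n,β',L}` for `0 ≤ β ≤ β'` only for ODD `n`, because the Ginibre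
inequality it rests on (`ginibreExpect_reChar_mono`) needs every element of the configuration group
to be a square. Ginibre's own treatment of the finite cyclic groups `ℤ_p` (Comm. Math. Phys. 16
(1970) 310–328, §2 Example 4, the discrete case p. 316–317: «one has to consider separately the two
subdomains that consist of points with both `α` and `β` even multiples or odd multiples of `π/p`»)
has no parity restriction; it is typed in
`Literature.Probability.LatticeModels.GinibreSqrtExt.ginibreExpect_reChar_mono_of_sqrtExt`
(square-root extensions `Ω ↪ Ω̃` of finite abelian groups). Here it is applied to the `ℤ_n` lattice
gauge theory of the tree (`znRep n`: link variables in `ℤ_n ⊂ U(1)`, Wilson action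
`β Σ_p (1 − Re z_p)`, product Haar measure, torus `(ℤ/Lℤ)^d`) through the linkwise inclusion
`ℤ_n^E ↪ ℤ_{2n}^E`: every `n`-th root of unity is the square of a `2n`-th root of unity
(`exists_mul_self_eq_inclusion_rootsOfUnityCircle`), and the plaquette and loop characters of the
`ℤ_n` theory are the restrictions of those of the `ℤ_{2n}` theory (definitionally: both are the `U(1)`
characters of the underlying `U(1)`-valued configuration).

* `zn_wilsonExpectation_wilsonLoop_mono_of_neZero`: for every `n ≥ 1`, `0 ≤ β ≤ β'`, every torus,
  base point, plane and side lengths, `⟨W_{R×T}⟩_{ℤ_n,β,L} ≤ ⟨W_{R×T}⟩_{ℤ_n,β',L}` — in particular for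
  the `ℤ₂` (Wegner) and `ℤ₄` gauge theories, where `z ↦ z²` is not onto;
* `zn_wilsonExpectation_wilsonLoop_nonneg_of_neZero`: Griffiths' first inequality
  `0 ≤ ⟨W_{R×T}⟩_{ℤ_n,β,L}` for every `n ≥ 1`, `β ≥ 0` (from the second one and the free theory,
  `ginibreExpect_reChar_nonneg_of_sqrtExt`);
* the unitary-gauge `ℤ_n` gauge–Higgs model of `ZnCentreDominatedWilsonLoops.lean`
  (`abelianHiggsExpect`), every `n ≥ 1`: `zn_abelianHiggsExpect_reChar_nonneg_of_neZero`,
  `zn_abelianHiggsExpect_reChar_mono_of_neZero` (non-decreasing in `β` and in the Higgs coupling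
  `κ`), `zn_wilsonExpectation_le_abelianHiggsExpect_of_neZero` (charged matter only increases the
  loop) — the tree had these for odd `n` (`zn_wilsonExpectation_le_abelianHiggsExpect`);
* Griffiths II in covariance form for TWO torus Wilson loops, `⟨W_C⟩⟨W_{C'}⟩ ≤ ⟨W_C W_{C'}⟩`:
  `wilsonExpectation_charRep_wilsonLoop_mul_ge` (compact abelian `Γ` with surjective squaring, from the
  tree's `ginibreExpect_mul_reChar_ge`), `u1_wilsonExpectation_wilsonLoop_mul_ge`, and
  `zn_wilsonExpectation_wilsonLoop_mul_ge_of_neZero` for EVERY `n` (square-root extension).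

HONEST LABEL: a finite-volume correlation inequality (monotonicity of torus Wilson loops in `β`) for
the abelian `ℤ_n` lattice gauge theory; it says nothing about the Yang–Mills mass gap (Clay), the
continuum limit or weak coupling, and the `ℤ_n` theory deconfines at weak coupling in `d = 3, 4`
(tree barriers `ZnHiggsPhaseD4`, `DiscreteSubgroupFreezing`).

## References

* J. Ginibre, *General formulation of Griffiths' inequalities*, Comm. Math. Phys. 16 (1970)
  310–328, §2 Example 4 (discrete case) and Model 3. [Ginibre1970]
* I. Montvay, G. Münster, *Quantum Fields on a Lattice*, CUP 1994, §3.7 (3.458) (`ℤ_n ⊂ U(1)`).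
  [MontvayMunster1994]
-/

noncomputable section

open MeasureTheory
open Literature.Probability.LatticeModels Literature.MathematicalPhysics.QuantumLattice
open Literature.Barriers.QuantumFields (rootsOfUnityCircle mem_rootsOfUnityCircle znRep)

namespace Literature.MathematicalPhysics.QuantumFieldTheory

/-! ### `ℤ_n ⊂ ℤ_{2n}`: a square-root extension inside `U(1)` -/

section RootsOfUnity

/-- `ℤ_n ≤ ℤ_{kn}` as subgroups of `U(1)` (`zⁿ = 1 ⇒ z^{kn} = 1`). [cite: MontvayMunster1994, §3.7 (3.458) (PDF p. 163)] -/
theorem rootsOfUnityCircle_le_mul (n k : ℕ) : rootsOfUnityCircle n ≤ rootsOfUnityCircle (k * n) := by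
  intro z hz
  rw [mem_rootsOfUnityCircle] at hz ⊢
  rw [pow_mul', hz, one_pow]

/-- `ℤ_n ≤ ℤ_{2n}`. [cite: Ginibre1970, §2 Example 4 (discrete case, p. 317)] -/
theorem rootsOfUnityCircle_le_two_mul (n : ℕ) : rootsOfUnityCircle n ≤ rootsOfUnityCircle (2 * n) :=
  rootsOfUnityCircle_le_mul n 2

/-- **Every `n`-th root of unity is the square of a `2n`-th root of unity** (`e^{2πik/n} =
(e^{πik/n})²`): the square-root extension `ℤ_n ↪ ℤ_{2n}` behind Ginibre's parity decomposition for
cyclic groups of even order. [cite: Ginibre1970, §2 Example 4 (discrete case, p. 317)] -/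
theorem exists_mul_self_eq_inclusion_rootsOfUnityCircle (n : ℕ) (z : ↥(rootsOfUnityCircle n)) :
    ∃ w : ↥(rootsOfUnityCircle (2 * n)),
      w * w = Subgroup.inclusion (rootsOfUnityCircle_le_two_mul n) z := by
  set u : Circle := Circle.exp (Complex.arg ((z : Circle) : ℂ) / 2) with hu
  have huu : u * u = (z : Circle) := by
    rw [hu, ← Circle.exp_add, add_halves, Circle.exp_arg]
  have hmem : u ∈ rootsOfUnityCircle (2 * n) := by
    rw [mem_rootsOfUnityCircle, pow_mul, pow_two, huu]
    exact mem_rootsOfUnityCircle.1 z.2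
  exact ⟨⟨u, hmem⟩, Subtype.ext huu⟩

end RootsOfUnity

/-! ### Griffiths' second inequality in `β` for `ℤ_n` torus Wilson loops, all `n` -/

section Monotone

variable {d L : ℕ} [NeZero L]

/-- **`ℤ_n` torus Wilson loops are non-decreasing in `β ≥ 0`, for every `n ≥ 1`** (Griffiths'
second inequality in the coupling for the clock gauge group `ℤ_n ⊂ U(1)`; Ginibre 1970 §2 Example 4,
discrete case, with Model 3): `⟨W_{R×T}⟩_{ℤ_n,β,L} ≤ ⟨W_{R×T}⟩_{ℤ_n,β',L}` for `0 ≤ β ≤ β'`, on every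
torus `(ℤ/Lℤ)^d`, for every base point, plane and side lengths. The odd case is the tree's
`zn_wilsonExpectation_wilsonLoop_mono`; the present proof covers even `n` (`ℤ₂`, `ℤ₄`, …) through
the square-root extension `ℤ_n^E ↪ ℤ_{2n}^E` and `ginibreExpect_reChar_mono_of_sqrtExt`.
[cite: Ginibre1970, §2 Example 4 (discrete case, p. 316–317) with Model 3] -/
theorem zn_wilsonExpectation_wilsonLoop_mono_of_neZero {n : ℕ} [NeZero n] {β β' : ℝ} (hβ : 0 ≤ β)
    (hββ' : β ≤ β') (x : Site d L) (i j : Fin d) (R T : ℕ) :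
    wilsonExpectation (L := L) (znRep n) β (wilsonLoop (znRep n) x i j R T) ≤
      wilsonExpectation (L := L) (znRep n) β' (wilsonLoop (znRep n) x i j R T) := by
  rw [← charRep_znIncl, wilsonExpectation_charRep_eq_ginibreExpect,
    wilsonExpectation_charRep_eq_ginibreExpect]
  have h2 := rootsOfUnityCircle_le_two_mul n
  exact GinibreSqrtExt.ginibreExpect_reChar_mono_of_sqrtExt
    (Measure.pi fun _ : Edge d L => haarProbability ↥(rootsOfUnityCircle n))
    (MonoidHom.compLeft (Subgroup.inclusion h2) (Edge d L))
    (Subgroup.inclusion_injective h2).comp_left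
    (GinibreSqrtExt.exists_mul_self_eq_compLeft _ (exists_mul_self_eq_inclusion_rootsOfUnityCircle n))
    (abelianPlaquetteChars (znIncl n) d L) (abelianRectChar (znIncl n) x i j R T)
    (abelianPlaquetteChars (znIncl (2 * n)) d L) (abelianRectChar (znIncl (2 * n)) x i j R T)
    (fun _ _ => rfl) (fun _ => rfl) (fun _ => hβ) (fun _ => hββ')

/-- The `n ≥ 1` form with an explicit hypothesis instead of `[NeZero n]`. [cite: Ginibre1970, §2 Example 4 (discrete case, p. 316–317) with Model 3] -/
theorem zn_wilsonExpectation_wilsonLoop_mono' {n : ℕ} (hn : n ≠ 0) {β β' : ℝ} (hβ : 0 ≤ β)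
    (hββ' : β ≤ β') (x : Site d L) (i j : Fin d) (R T : ℕ) :
    wilsonExpectation (L := L) (znRep n) β (wilsonLoop (znRep n) x i j R T) ≤
      wilsonExpectation (L := L) (znRep n) β' (wilsonLoop (znRep n) x i j R T) := by
  haveI : NeZero n := ⟨hn⟩
  exact zn_wilsonExpectation_wilsonLoop_mono_of_neZero hβ hββ' x i j R T

/-- **Griffiths' first inequality for `ℤ_n` torus Wilson loops, every `n ≥ 1`**:
`0 ≤ ⟨W_{R×T}⟩_{ℤ_n,β,L}` for `β ≥ 0` — by monotonicity from `β = 0`, where the loop expectation is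
the Haar integral of `Re` of a character, `∈ {0, 1}`. (Odd `n`: the tree's
`wilsonExpectation_charRep_wilsonLoop_nonneg`.) [cite: Ginibre1970, Prop. 3 with §2 Example 4 (discrete case) and Model 3] -/
theorem zn_wilsonExpectation_wilsonLoop_nonneg_of_neZero {n : ℕ} [NeZero n] {β : ℝ} (hβ : 0 ≤ β)
    (x : Site d L) (i j : Fin d) (R T : ℕ) :
    0 ≤ wilsonExpectation (L := L) (znRep n) β (wilsonLoop (znRep n) x i j R T) := by
  rw [← charRep_znIncl, wilsonExpectation_charRep_eq_ginibreExpect]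
  have h2 := rootsOfUnityCircle_le_two_mul n
  exact GinibreSqrtExt.ginibreExpect_reChar_nonneg_of_sqrtExt
    (Measure.pi fun _ : Edge d L => haarProbability ↥(rootsOfUnityCircle n))
    (MonoidHom.compLeft (Subgroup.inclusion h2) (Edge d L))
    (Subgroup.inclusion_injective h2).comp_left
    (GinibreSqrtExt.exists_mul_self_eq_compLeft _ (exists_mul_self_eq_inclusion_rootsOfUnityCircle n))
    (abelianPlaquetteChars (znIncl n) d L) (abelianRectChar (znIncl n) x i j R T)
    (abelianPlaquetteChars (znIncl (2 * n)) d L) (abelianRectChar (znIncl (2 * n)) x i j R T)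
    (fun _ _ => rfl) (fun _ => rfl) (fun _ => hβ)

end Monotone

/-! ### The unitary-gauge `ℤ_n` gauge–Higgs model, all `n` -/

section Higgs

variable {d L : ℕ} [NeZero L]

omit [NeZero L] in
/-- The interaction characters of the `ℤ_n` gauge–Higgs model (plaquettes and links) are the
restrictions of those of the `ℤ_{2n}` model along `ℤ_n^E ↪ ℤ_{2n}^E` (both are `U(1)` characters of
the underlying configuration). [cite: MarraMiraclesole1979, §1 eq. (3)] -/
theorem abelianHiggsChars_znIncl_eq_comp (n : ℕ) (a : Plaquette d L ⊕ Edge d L)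
    (σ : GaugeConfig d L ↥(rootsOfUnityCircle n)) :
    abelianHiggsChars (znIncl n) d L a σ = abelianHiggsChars (znIncl (2 * n)) d L a
      (MonoidHom.compLeft (Subgroup.inclusion (rootsOfUnityCircle_le_two_mul n)) (Edge d L) σ) := by
  cases a <;> rfl

/-- **Griffiths' second inequality in the couplings for the `ℤ_n` gauge–Higgs model, every
`n ≥ 1`**: the unitary-gauge loop expectation `⟨Re σ_{∂R×T}⟩_{β,κ}` is non-decreasing in `β` and in
the Higgs coupling `κ` (`0 ≤ β ≤ β'`, `0 ≤ κ ≤ κ'`). (Surjective squaring, e.g. odd `n`: the tree's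
`abelianHiggsExpect_reChar_mono`.) [cite: Ginibre1970, §2 Example 4 (discrete case, p. 316–317) with Model 3] [cite: MarraMiraclesole1979, §1 eq. (3)] -/
theorem zn_abelianHiggsExpect_reChar_mono_of_neZero {n : ℕ} [NeZero n] {β β' κ κ' : ℝ} (hβ : 0 ≤ β)
    (hββ' : β ≤ β') (hκ : 0 ≤ κ) (hκκ' : κ ≤ κ') (x : Site d L) (i j : Fin d) (R T : ℕ) :
    abelianHiggsExpect (znIncl n) β κ (reChar (abelianRectChar (znIncl n) x i j R T)) ≤
      abelianHiggsExpect (L := L) (znIncl n) β' κ' (reChar (abelianRectChar (znIncl n) x i j R T)) := by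
  have h2 := rootsOfUnityCircle_le_two_mul n
  exact GinibreSqrtExt.ginibreExpect_reChar_mono_of_sqrtExt
    (Measure.pi fun _ : Edge d L => haarProbability ↥(rootsOfUnityCircle n))
    (MonoidHom.compLeft (Subgroup.inclusion h2) (Edge d L))
    (Subgroup.inclusion_injective h2).comp_left
    (GinibreSqrtExt.exists_mul_self_eq_compLeft _ (exists_mul_self_eq_inclusion_rootsOfUnityCircle n))
    (abelianHiggsChars (znIncl n) d L) (abelianRectChar (znIncl n) x i j R T)
    (abelianHiggsChars (znIncl (2 * n)) d L) (abelianRectChar (znIncl (2 * n)) x i j R T)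
    (abelianHiggsChars_znIncl_eq_comp n) (fun _ => rfl)
    (fun a => by cases a <;> simp [abelianHiggsCoupling, hβ, hκ])
    (fun a => by cases a <;> simp [abelianHiggsCoupling, hββ', hκκ'])

/-- **Griffiths' first inequality for the `ℤ_n` gauge–Higgs model, every `n ≥ 1`**:
`0 ≤ ⟨Re σ_{∂R×T}⟩_{β,κ}` for `β, κ ≥ 0`. [cite: Ginibre1970, Prop. 3 with §2 Example 4 (discrete case) and Model 3] -/
theorem zn_abelianHiggsExpect_reChar_nonneg_of_neZero {n : ℕ} [NeZero n] {β κ : ℝ} (hβ : 0 ≤ β)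
    (hκ : 0 ≤ κ) (x : Site d L) (i j : Fin d) (R T : ℕ) :
    0 ≤ abelianHiggsExpect (L := L) (znIncl n) β κ (reChar (abelianRectChar (znIncl n) x i j R T)) := by
  have h2 := rootsOfUnityCircle_le_two_mul n
  exact GinibreSqrtExt.ginibreExpect_reChar_nonneg_of_sqrtExt
    (Measure.pi fun _ : Edge d L => haarProbability ↥(rootsOfUnityCircle n))
    (MonoidHom.compLeft (Subgroup.inclusion h2) (Edge d L))
    (Subgroup.inclusion_injective h2).comp_left
    (GinibreSqrtExt.exists_mul_self_eq_compLeft _ (exists_mul_self_eq_inclusion_rootsOfUnityCircle n))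
    (abelianHiggsChars (znIncl n) d L) (abelianRectChar (znIncl n) x i j R T)
    (abelianHiggsChars (znIncl (2 * n)) d L) (abelianRectChar (znIncl (2 * n)) x i j R T)
    (abelianHiggsChars_znIncl_eq_comp n) (fun _ => rfl)
    (fun a => by cases a <;> simp [abelianHiggsCoupling, hβ, hκ])

/-- **Charged matter only increases the `ℤ_n` Wilson loops, every `n ≥ 1`**: the pure `ℤ_n` torus
Wilson loop bounds the unitary-gauge `ℤ_n` Higgs-model loop from below,
`⟨W_{R×T}⟩_{ℤ_n,β,L} ≤ ⟨Re σ_{∂R×T}⟩_{β,κ,L}` for `β, κ ≥ 0` (odd `n`: the tree's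
`zn_wilsonExpectation_le_abelianHiggsExpect`). HONEST LABEL: an inequality between two abelian
lattice models in finite volume. [cite: Ginibre1970, §2 Example 4 (discrete case, p. 316–317) with Model 3] [cite: MarraMiraclesole1979, §1 p. 235] -/
theorem zn_wilsonExpectation_le_abelianHiggsExpect_of_neZero {n : ℕ} [NeZero n] {β κ : ℝ}
    (hβ : 0 ≤ β) (hκ : 0 ≤ κ) (x : Site d L) (i j : Fin d) (R T : ℕ) :
    wilsonExpectation (L := L) (znRep n) β (wilsonLoop (znRep n) x i j R T) ≤
      abelianHiggsExpect (znIncl n) β κ (reChar (abelianRectChar (znIncl n) x i j R T)) := by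
  rw [← charRep_znIncl, ← abelianHiggsExpect_zero_eq_wilsonExpectation]
  exact zn_abelianHiggsExpect_reChar_mono_of_neZero hβ le_rfl le_rfl hκ x i j R T

end Higgs

/-! ### Two torus Wilson loops are positively correlated (Griffiths II, covariance form) -/

section TwoLoops

variable {d L : ℕ} [NeZero L] {Γ : Type*} [CommGroup Γ] [TopologicalSpace Γ] [IsTopologicalGroup Γ]
  [CompactSpace Γ] [SecondCountableTopology Γ] [MeasurableSpace Γ] [BorelSpace Γ] (φ : Γ →ₜ* Circle)

/-- **Every torus expectation of the abelian `Γ` theory in the representation `charRep φ` is a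
Ginibre expectation** with constant couplings `β` (the tree's
`wilsonExpectation_charRep_eq_ginibreExpect` for an arbitrary observable `F`).
[cite: Ginibre1970, §2 Example 4 with Model 3 (plane rotators and their subgroups)] -/
theorem wilsonExpectation_charRep_eq_ginibreExpect_of (β : ℝ) (F : GaugeConfig d L Γ → ℝ) :
    wilsonExpectation (L := L) (charRep φ) β F =
      ginibreExpect (Measure.pi fun _ : Edge d L => haarProbability Γ)
        (abelianPlaquetteChars φ d L) (fun _ => β) F := by
  rw [wilsonExpectation_eq_div_integral (charRep φ) (continuous_charRep φ), ginibreExpect]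
  simp_rw [exp_neg_mul_wilsonAction_charRep]
  set c := Real.exp (-β * Fintype.card (Plaquette d L))
  have hc : c ≠ 0 := (Real.exp_pos _).ne'
  simp_rw [mul_left_comm _ c, integral_const_mul]
  rw [mul_div_mul_left _ _ hc]

omit [NeZero L] [TopologicalSpace Γ] [IsTopologicalGroup Γ] [CompactSpace Γ] [SecondCountableTopology Γ]
  [MeasurableSpace Γ] [BorelSpace Γ] in
/-- Linkwise square roots. [folklore] -/
private theorem surjective_mul_self_config' (hΓ : Function.Surjective fun γ : Γ => γ * γ) :
    Function.Surjective fun ψ : GaugeConfig d L Γ => ψ * ψ := fun θ =>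
  ⟨fun e => Classical.choose (hΓ (θ e)), funext fun e => Classical.choose_spec (hΓ (θ e))⟩

/-- **Two torus Wilson loops of an abelian lattice gauge theory are positively correlated**
(Griffiths' second inequality, covariance form; Ginibre 1970 Prop. 3 with Example 4 / Model 3): for
a compact abelian `Γ` in which every element is a square, a continuous character `φ`, `β ≥ 0`, and any
two rectangles on the torus, `⟨W_C⟩ ⟨W_{C'}⟩ ≤ ⟨W_C W_{C'}⟩` in the `Γ` theory `charRep φ` at `β`
(the tree's `ginibreExpect_mul_reChar_ge` in the Wilson-loop currency). [cite: Ginibre1970, Prop. 3 with §2 Example 4 and Model 3] -/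
theorem wilsonExpectation_charRep_wilsonLoop_mul_ge (hΓ : Function.Surjective fun γ : Γ => γ * γ)
    {β : ℝ} (hβ : 0 ≤ β) (x x' : Site d L) (i j i' j' : Fin d) (R T R' T' : ℕ) :
    wilsonExpectation (L := L) (charRep φ) β (wilsonLoop (charRep φ) x i j R T) *
        wilsonExpectation (L := L) (charRep φ) β (wilsonLoop (charRep φ) x' i' j' R' T') ≤
      wilsonExpectation (L := L) (charRep φ) β
        (fun σ => wilsonLoop (charRep φ) x i j R T σ * wilsonLoop (charRep φ) x' i' j' R' T' σ) := by
  rw [wilsonExpectation_charRep_eq_ginibreExpect, wilsonExpectation_charRep_eq_ginibreExpect,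
    wilsonExpectation_charRep_eq_ginibreExpect_of]
  simp_rw [wilsonLoop_charRep]
  exact ginibreExpect_mul_reChar_ge _ (surjective_mul_self_config' hΓ) _ _ _ (fun _ => hβ)

/-- Every element of `U(1)` is a square. [folklore] -/
private theorem surjective_mul_self_circle' : Function.Surjective fun ψ : Circle => ψ * ψ := fun θ =>
  ⟨Circle.exp (Complex.arg (θ : ℂ) / 2), by
    show Circle.exp _ * Circle.exp _ = θ
    rw [← Circle.exp_add, add_halves, Circle.exp_arg]⟩

/-- **`U(1)`: two torus Wilson loops of compact QED are positively correlated** at every `β ≥ 0`, on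
every torus: `⟨W_C⟩⟨W_{C'}⟩ ≤ ⟨W_C W_{C'}⟩`. [cite: Ginibre1970, Prop. 3 with §2 Example 4 and Model 3] -/
theorem u1_wilsonExpectation_wilsonLoop_mul_ge {β : ℝ} (hβ : 0 ≤ β) (x x' : Site d L)
    (i j i' j' : Fin d) (R T R' T' : ℕ) :
    wilsonExpectation (L := L) u1Rep β (wilsonLoop u1Rep x i j R T) *
        wilsonExpectation (L := L) u1Rep β (wilsonLoop u1Rep x' i' j' R' T') ≤
      wilsonExpectation (L := L) u1Rep β
        (fun σ => wilsonLoop u1Rep x i j R T σ * wilsonLoop u1Rep x' i' j' R' T' σ) := by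
  have h := wilsonExpectation_charRep_wilsonLoop_mul_ge (d := d) (L := L) (ContinuousMonoidHom.id Circle)
    surjective_mul_self_circle' hβ x x' i j i' j' R T R' T'
  rwa [charRep_id_circle] at h

/-- **`ℤ_n`, EVERY `n ≥ 1`: two torus Wilson loops of the `ℤ_n` lattice gauge theory are positively
correlated** at every `β ≥ 0` (`⟨W_C⟩⟨W_{C'}⟩ ≤ ⟨W_C W_{C'}⟩`), through the square-root extension
`ℤ_n^E ↪ ℤ_{2n}^E` and `ginibreExpect_mul_reChar_ge_of_sqrtExt` (even `n` included).
[cite: Ginibre1970, Prop. 3 with §2 Example 4 (discrete case, p. 316–317) and Model 3] -/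
theorem zn_wilsonExpectation_wilsonLoop_mul_ge_of_neZero {n : ℕ} [NeZero n] {β : ℝ} (hβ : 0 ≤ β)
    (x x' : Site d L) (i j i' j' : Fin d) (R T R' T' : ℕ) :
    wilsonExpectation (L := L) (znRep n) β (wilsonLoop (znRep n) x i j R T) *
        wilsonExpectation (L := L) (znRep n) β (wilsonLoop (znRep n) x' i' j' R' T') ≤
      wilsonExpectation (L := L) (znRep n) β
        (fun σ => wilsonLoop (znRep n) x i j R T σ * wilsonLoop (znRep n) x' i' j' R' T' σ) := by
  rw [← charRep_znIncl, wilsonExpectation_charRep_eq_ginibreExpect,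
    wilsonExpectation_charRep_eq_ginibreExpect, wilsonExpectation_charRep_eq_ginibreExpect_of]
  simp_rw [wilsonLoop_charRep]
  have h2 := rootsOfUnityCircle_le_two_mul n
  exact GinibreSqrtExt.ginibreExpect_mul_reChar_ge_of_sqrtExt
    (Measure.pi fun _ : Edge d L => haarProbability ↥(rootsOfUnityCircle n))
    (MonoidHom.compLeft (Subgroup.inclusion h2) (Edge d L))
    (Subgroup.inclusion_injective h2).comp_left
    (GinibreSqrtExt.exists_mul_self_eq_compLeft _ (exists_mul_self_eq_inclusion_rootsOfUnityCircle n))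
    (abelianPlaquetteChars (znIncl n) d L) (abelianRectChar (znIncl n) x i j R T)
    (abelianRectChar (znIncl n) x' i' j' R' T') (abelianPlaquetteChars (znIncl (2 * n)) d L)
    (abelianRectChar (znIncl (2 * n)) x i j R T) (abelianRectChar (znIncl (2 * n)) x' i' j' R' T')
    (fun _ _ => rfl) (fun _ => rfl) (fun _ => rfl) (fun _ => hβ)

end TwoLoops

end Literature.MathematicalPhysics.QuantumFieldTheory

end
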